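import Literature.AlgebraicGeometry.Resolution.EffectiveCartierStalks
import Literature.AlgebraicGeometry.Limits.GenericFibreSpread
import Mathlib.AlgebraicGeometry.Morphisms.Smooth
import HarnessLib

/-!
# Restricting a family to an open of the base: fibres, smoothness and Cartier divisors

Topic: `Literature/AlgebraicGeometry/Resolution`. Packaging lemmas for the spreading-out argument
(`SpreadsShapedFromGenericPoint`, `CanonicalResolutionSpread.lean`): the spreading lemmas of
`SmoothGenericFibreSpread.lean`, `EffectiveCartierStalks.lean`, `SncModelSpread.lean` deliver
properties of a family `q : X → Spec A` at the POINTS over a basic open `D(a)`; the fibre-side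
theorems (`BlowupSequencesBaseChange.lean`, `StrictNormalCrossingsFibre.lean`) consume GLOBAL
properties of a family. One passes from the former to the latter by restricting to the open
subscheme `X₀ = q⁻¹ D(a)` (more generally along an open immersion `j : X₀ → X`). PROVED here:

* `exists_lift_isPullback_of_range_subset` — a cartesian square `(ι, s, q, g)` whose `g` lands
  in `D(a)` factors through `X₀ = q⁻¹ D(a)`, the factored square being cartesian;
  `exists_lift_isPullback_of_apply_ne_zero` (fibres over field-valued points `φ` with
  `φ a ≠ 0`), `exists_lift_isPullback_generic` (the generic fibre, `a ≠ 0`);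
* `isPullback_subschemeMap`, `isOpenImmersion_subschemeMap` — for an open immersion `j`, the
  natural morphism `V(j^*V) → V(V)` is an open immersion (a base change of `j`) with the
  expected image;
* `smooth_comap_subschemeι_comp_of_forall_mem_smoothLocus` — **if all points of `V(V)` over the
  image of `j` are smooth points of `V(V) → Spec A`, then `V(j^*V) → X₀ → X → Spec A` is smooth**;
  `smooth_zeroScheme_comap_of_forall_mem_smoothLocus` — the same for the zero scheme of a
  restricted divisor `D₀ · 𝒪_{V(V)}`;
* `isEffectiveCartier_comap_comap_subschemeι_of_forall_mem_cartierLocus` — **if all points of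
  `V(V)` over the image of `j` lie in the Cartier locus of `D₀ · 𝒪_{V(V)}`, then
  `(j^*D₀) · 𝒪_{V(j^*V)}` is an effective Cartier divisor**.

## Sources

* A. Grothendieck, J. Dieudonné, EGA IV₃ (1966), §8–§9 (spreading out over a dense open of the
  base). [folklore]
* The Stacks Project, Tags 01WS, 056P. [StacksProject]
-/

noncomputable section

open CategoryTheory CategoryTheory.Limits AlgebraicGeometry TopologicalSpace PrimeSpectrum

namespace Literature.AlgebraicGeometry.Resolution

universe u

open Scheme.IdealSheafData

/-! ## Fibres over `D(a)` factor through `q⁻¹ D(a)` -/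

section Lift

variable {A : Type u} [CommRing A] {X : Scheme.{u}} (q : X ⟶ Spec (.of A)) (a : A)

/-- **A cartesian square over `Spec A` whose base map lands in `D(a)` factors through the open
`X₀ = q⁻¹ D(a)`, and the factored square is cartesian** (`X₀ → X` is a monomorphism).
[folklore] -/
theorem exists_lift_isPullback_of_range_subset {S P : Scheme.{u}} {ι : P ⟶ X} {s : P ⟶ S}
    {g : S ⟶ Spec (.of A)} (HX : IsPullback ι s q g)
    (hg : Set.range g ⊆ (basicOpen a : Set (PrimeSpectrum A))) :
    ∃ ι₀ : P ⟶ (q ⁻¹ᵁ basicOpen a : X.Opens),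
      ι₀ ≫ (q ⁻¹ᵁ basicOpen a).ι = ι ∧ IsPullback ι₀ s ((q ⁻¹ᵁ basicOpen a).ι ≫ q) g := by
  have hrange : Set.range ι ⊆ Set.range (q ⁻¹ᵁ basicOpen a : X.Opens).ι := by
    rw [Scheme.Opens.range_ι]
    rintro _ ⟨p, rfl⟩
    show q (ι p) ∈ basicOpen a
    rw [← Scheme.Hom.comp_apply, HX.w, Scheme.Hom.comp_apply]
    exact hg ⟨s p, rfl⟩
  refine ⟨IsOpenImmersion.lift _ ι hrange, IsOpenImmersion.lift_fac _ _ _, ?_⟩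
  have H1 : IsPullback (IsOpenImmersion.lift _ ι hrange) (𝟙 P) (q ⁻¹ᵁ basicOpen a).ι ι :=
    IsPullback.of_vert_isIso_mono ⟨by rw [IsOpenImmersion.lift_fac, Category.id_comp]⟩
  simpa using H1.paste_vert HX

/-- **Fibres over field-valued points `φ` with `φ a ≠ 0` factor through `q⁻¹ D(a)`**, the factored
square being cartesian. [folklore] -/
theorem exists_lift_isPullback_of_apply_ne_zero {k : Type u} [Field k] (φ : A →+* k)
    (hφ : φ a ≠ 0) {P : Scheme.{u}} {ι : P ⟶ X} {s : P ⟶ Spec (.of k)}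
    (HX : IsPullback ι s q (Spec.map (CommRingCat.ofHom φ))) :
    ∃ ι₀ : P ⟶ (q ⁻¹ᵁ basicOpen a : X.Opens),
      ι₀ ≫ (q ⁻¹ᵁ basicOpen a).ι = ι ∧
        IsPullback ι₀ s ((q ⁻¹ᵁ basicOpen a).ι ≫ q) (Spec.map (CommRingCat.ofHom φ)) :=
  exists_lift_isPullback_of_range_subset q a HX (by
    rintro _ ⟨x, rfl⟩
    exact (Literature.AlgebraicGeometry.Limits.specMap_mem_basicOpen_iff φ a x).mpr hφ)

/-- **The generic fibre factors through `q⁻¹ D(a)` for `a ≠ 0`**, the factored square being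
cartesian. [folklore] -/
theorem exists_lift_isPullback_generic [IsDomain A] (K : Type u) [Field K] [Algebra A K]
    [IsFractionRing A K] (ha : a ≠ 0) {P : Scheme.{u}} {ι : P ⟶ X} {s : P ⟶ Spec (.of K)}
    (HX : IsPullback ι s q (specOfAlgebra A K)) :
    ∃ ι₀ : P ⟶ (q ⁻¹ᵁ basicOpen a : X.Opens),
      ι₀ ≫ (q ⁻¹ᵁ basicOpen a).ι = ι ∧
        IsPullback ι₀ s ((q ⁻¹ᵁ basicOpen a).ι ≫ q) (specOfAlgebra A K) :=
  exists_lift_isPullback_of_range_subset q a HX (by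
    rintro _ ⟨x, rfl⟩
    show Spec.map (CommRingCat.ofHom (algebraMap A K)) x ∈ (basicOpen a : Set (PrimeSpectrum A))
    rw [specMap_fractionRing_apply K x]
    exact (Literature.AlgebraicGeometry.Limits.bot_mem_basicOpen_iff a).mpr ha)

end Lift

/-! ## Closed subschemes along an open immersion -/

section Subscheme

variable {X X₀ : Scheme.{u}} (j : X₀ ⟶ X) (V : X.IdealSheafData)

/-- The square `(V(j^*V) → V(V), V(j^*V) → X₀, V(V) → X, j)` is cartesian (Mathlib's
`comapIso`). [folklore] -/
theorem isPullback_subschemeMap :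
    IsPullback (subschemeMap (V.comap j) V j (V.le_map_comap j)) (V.comap j).subschemeι
      V.subschemeι j :=
  IsPullback.of_iso_pullback ⟨subschemeMap_subschemeι _ _ _ _⟩
    (V.comapIso j ≪≫ pullbackSymmetry _ _)
    (by rw [Iso.trans_hom, Category.assoc, pullbackSymmetry_hom_comp_fst, comapIso_hom_snd])
    (by rw [Iso.trans_hom, Category.assoc, pullbackSymmetry_hom_comp_snd, comapIso_hom_fst])

/-- For an open immersion `j`, the natural morphism `V(j^*V) → V(V)` is an open immersion.
[folklore] -/
instance isOpenImmersion_subschemeMap [IsOpenImmersion j] :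
    IsOpenImmersion (subschemeMap (V.comap j) V j (V.le_map_comap j)) :=
  MorphismProperty.of_isPullback (isPullback_subschemeMap j V).flip inferInstance

/-- The image of `V(j^*V) → V(V)` is the preimage of the image of `j`. [folklore] -/
theorem range_subschemeMap_comap :
    Set.range (subschemeMap (V.comap j) V j (V.le_map_comap j)) = V.subschemeι ⁻¹' Set.range j := by
  have H := isPullback_subschemeMap j V
  have hsurj : Set.range (H.isoPullback.hom) = Set.univ :=
    Set.range_eq_univ.mpr H.isoPullback.hom.surjective
  rw [← H.isoPullback_hom_fst, Scheme.Hom.comp_base, TopCat.coe_comp, Set.range_comp, hsurj,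
    Set.image_univ, Scheme.Pullback.range_fst]

/-- `(D₀ · 𝒪_{V(V)}) · 𝒪_{V(j^*V)} = (j^*D₀) · 𝒪_{V(j^*V)}`. [folklore] -/
theorem comap_comap_subschemeMap (D₀ : X.IdealSheafData) :
    (D₀.comap V.subschemeι).comap (subschemeMap (V.comap j) V j (V.le_map_comap j)) =
      (D₀.comap j).comap (V.comap j).subschemeι := by
  rw [← comap_comp, subschemeMap_subschemeι, comap_comp]

end Subscheme

/-! ## From pointwise properties over the image of `j` to global properties of the restriction -/

section Packaging

variable {A : Type u} [CommRing A] {X X₀ : Scheme.{u}} (q : X ⟶ Spec (.of A)) (j : X₀ ⟶ X)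
  [IsOpenImmersion j]

/-- **Smoothness of the restricted closed subscheme**: if every point of `V(V)` over the image of
the open immersion `j` is a smooth point of `V(V) → Spec A`, then `V(j^*V) → X₀ → X → Spec A` is
smooth (it is the open immersion `V(j^*V) → V(V)` followed by `V(V) → Spec A`, and lands in the
smooth locus). [folklore] -/
theorem smooth_comap_subschemeι_comp_of_forall_mem_smoothLocus (V : X.IdealSheafData)
    [LocallyOfFinitePresentation (V.subschemeι ≫ q)]
    (h : ∀ z : V.subscheme, V.subschemeι z ∈ Set.range j → z ∈ (V.subschemeι ≫ q).smoothLocus) :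
    Smooth ((V.comap j).subschemeι ≫ j ≫ q) := by
  set m := subschemeMap (V.comap j) V j (V.le_map_comap j) with hm
  have he : (V.comap j).subschemeι ≫ j ≫ q = m ≫ (V.subschemeι ≫ q) := by
    rw [← Category.assoc, ← subschemeMap_subschemeι _ _ _ (V.le_map_comap j), Category.assoc]
  rw [he, ← Scheme.Hom.smoothLocus_eq_top_iff, ← Scheme.Hom.preimage_smoothLocus_eq]
  refine top_le_iff.mp fun z _ => ?_
  refine h (m z) ?_
  have hmem : m z ∈ Set.range m := ⟨z, rfl⟩
  rwa [range_subschemeMap_comap j V] at hmem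

/-- **Smoothness of the restricted zero scheme of a restricted divisor**: if every point of the
zero scheme `V(D₀ · 𝒪_{V(V)})` over the image of `j` is a smooth point of its structure morphism
to `Spec A`, then the zero scheme of `(j^*D₀) · 𝒪_{V(j^*V)}`, with its structure morphism
`→ V(j^*V) → X₀ → X → Spec A`, is smooth. [folklore] -/
theorem smooth_zeroScheme_comap_of_forall_mem_smoothLocus (V D₀ : X.IdealSheafData)
    [LocallyOfFinitePresentation ((D₀.comap V.subschemeι).subschemeι ≫ V.subschemeι ≫ q)]
    (h : ∀ z : (D₀.comap V.subschemeι).subscheme,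
      V.subschemeι ((D₀.comap V.subschemeι).subschemeι z) ∈ Set.range j →
        z ∈ ((D₀.comap V.subschemeι).subschemeι ≫ V.subschemeι ≫ q).smoothLocus) :
    Smooth (((D₀.comap j).comap (V.comap j).subschemeι).subschemeι ≫
      (V.comap j).subschemeι ≫ j ≫ q) := by
  set m := subschemeMap (V.comap j) V j (V.le_map_comap j) with hm
  have key := smooth_comap_subschemeι_comp_of_forall_mem_smoothLocus (V.subschemeι ≫ q) m
    (D₀.comap V.subschemeι) fun z hz => h z (by
      obtain ⟨z', hz'⟩ := hz
      have : V.subschemeι ((D₀.comap V.subschemeι).subschemeι z) ∈ Set.range j := by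
        rw [← hz', ← Scheme.Hom.comp_apply]
        have hr := range_subschemeMap_comap j V
        have hmem : m z' ∈ Set.range m := ⟨z', rfl⟩
        rw [hr] at hmem
        exact hmem
      exact this)
  have he : m ≫ V.subschemeι ≫ q = (V.comap j).subschemeι ≫ j ≫ q := by
    rw [← Category.assoc, subschemeMap_subschemeι, Category.assoc]
  rw [he, comap_comap_subschemeMap] at key
  exact key

/-- **The restricted divisor is an effective Cartier divisor on the restricted subscheme**: if
every point of `V(V)` over the image of `j` lies in the Cartier locus of `D₀ · 𝒪_{V(V)}`, then
`(j^*D₀) · 𝒪_{V(j^*V)}` is an effective Cartier divisor (`V(j^*V) → V(V)` is an open immersion,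
inducing isomorphisms of local rings). [cite: StacksProject, Tag 01WS] -/
theorem isEffectiveCartier_comap_comap_subschemeι_of_forall_mem_cartierLocus
    [IsLocallyNoetherian X] (V D₀ : X.IdealSheafData)
    (h : ∀ z : V.subscheme, V.subschemeι z ∈ Set.range j → z ∈ cartierLocus (D₀.comap V.subschemeι)) :
    IsEffectiveCartier ((D₀.comap j).comap (V.comap j).subschemeι) := by
  haveI : IsLocallyNoetherian X₀ := LocallyOfFiniteType.isLocallyNoetherian j
  haveI : IsLocallyNoetherian (V.comap j).subscheme :=
    LocallyOfFiniteType.isLocallyNoetherian (V.comap j).subschemeι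
  set m := subschemeMap (V.comap j) V j (V.le_map_comap j) with hm
  rw [← comap_comap_subschemeMap j V D₀]
  refine (isEffectiveCartier_iff_forall_mem_cartierLocus _).mpr fun z => ?_
  refine (mem_cartierLocus_comap_iff m z _).mpr (h (m z) ?_)
  have hmem : m z ∈ Set.range m := ⟨z, rfl⟩
  rwa [range_subschemeMap_comap j V] at hmem

end Packaging

end Literature.AlgebraicGeometry.Resolution

end
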